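import Literature.RepresentationTheory.FiniteGroups.SymmetricGroupSquareEvaluation
import HarnessLib

/-!
# Gesmundo–Ikenmeyer–Panova 2017, Prop. 18 (corrected): the kernel computations (H: `n = 21`)

Sibling proofs file (D-0014; theorems only) of
`Literature/Barriers/ValiantsHypothesis/GCTMatrixPoweringErratum.lean` (the named fact
`GIP2017_prop18_corrected`: "Let `λ` be a partition of length `ℓ ≤ 14` and `λ` not one of the ten
exceptional shapes. Then `sm(λ, 7) > 0`", GIP Prop. 18 with the shape `(2,1³)` added to the
exceptional list) and of the assembly `GCTMatrixPoweringProp18.lean`, which PROVES that fact from the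
semigroup property (Prop. 15, proved in `GCTMatrixPoweringSemigroup.lean`) and finitely many
positivity atoms `sk(λ, μ) > 0` / `ak(λ, μ) > 0`. GIP prove Prop. 18 by "a program written by Harm
Derksen and adjusted by Jesko Hüttenhain ... A direct computation for partitions `λ` with
`ℓ(λ) ≤ 12` and `λ₁ ≤ 3`" and the semigroup property; here the computations are certified in the
kernel: each theorem below states that the character sum
`skSumT n λᵗ μ = Σ_σ χ^λ(σ)(χ^μ(σ)² + χ^μ(σ²)) = 2·n!·sk(λ, μ)` (resp. `akSumT`, `2·n!·ak(λ, μ)`) of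
the verified evaluator of `Literature/RepresentationTheory/FiniteGroups/SymmetricGroupSquareEvaluation.lean`
(`sum_symSq_eq_skSumT`, `sum_extSq_eq_akSumT`) is nonzero, for the shape `λ` with the listed
COLUMN lengths (the parts of `λᵗ`) and an explicit witness `μ` with at most `7` (in fact `≤ 4`)
rows, by one `decide` in the kernel (`𝔖_{21}`). The witnesses were found by a search outside the
kernel; only their verification is used.

## References

* F. Gesmundo, C. Ikenmeyer, G. Panova, *Geometric complexity theory and matrix powering*,
  Diff. Geom. Appl. 55 (2017) 106–127 = arXiv:1611.00827, Prop. 18 and its proof (the computer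
  calculation), §3. [GesmundoIkenmeyerPanova2017]
-/

namespace Literature.Barriers.ValiantsHypothesis

open Literature.RepresentationTheory.FiniteGroups.MNEval

set_option maxHeartbeats 100000000 in
set_option maxRecDepth 100000 in
/-- `sk((2,2,2,2,2,2,2,1,1,1,1,1,1,1), (6,6,5,4)) > 0` (`= 1`; columns `[14, 7]`, `𝔖_{21}`), by the verified evaluator.
[cite: GesmundoIkenmeyerPanova2017, Prop. 18 (the computer calculation)] -/
theorem skc_14_7 : skSumT 21 [14, 7] [6, 6, 5, 4] ≠ 0 := by
  decide +kernel

end Literature.Barriers.ValiantsHypothesis
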